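import Literature.MathematicalPhysics.QuantumFieldTheory.Balaban1983to89.B8SectDSource

/-!
# `Balaban1983to89.B8SectEStatements` — B8 Sect. E (pp. 95–97): the linearizing transformation
# `λ′ = λ − H′D′(λ)` (1.113), the fixed-point construction of `D′(λ)` (1.116)–(1.121), and the identity (1.114)

statement-level skeleton of published theorems with citation tags; proofs where landed; nothing here is a claim
about the Yang–Mills mass gap

CITATION HEADER (lean-in-tree rule 2026-08-18; mega-formalization `lit-balaban`, reader/typer seat r05 — SKELETON
rows `B8.Eq1.113`, `B8.Eq1.121`, `B8.Eq1.125` of `HOME/lit-balaban-r05/ROWS-B8.md`; interface locus `B8.Eq1.115-1.123`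
of `HOME/INTERFACES.md` §1.3, NE3).  T. Bałaban, *Spaces of regular gauge field configurations on a lattice and gauge
fixing conditions*, Commun. Math. Phys. **99** (1985) 75–102 `[Balaban1985RegularSpaces]` ("B8").
PDF held: `paper:balaban1985-cmp99-regular-spaces-gauge-fixing` (journal page = PDF page + 74); pages read: pp. 95–97
[PDF 21–23] (text `p0021.txt`–`p0023.txt`; render `1985-cmp99-regular-spaces-gauge-fixing-p023-x2.png` for (1.125)
and the closing paragraph).  v1.1 (r05 gen 24, literature-prover-lit-balaban-r05-g24-0): DOCSTRING-ONLY — two cite-tag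
page numerals corrected after r12 gen 14 CITELOC-SWEEP §8 / r05 QUOTE-AUDIT-B8 §3: (1.113)–(1.114) are the last
displays of p. 95 [PDF 21] (text layer `p0021.txt` L31/L33), (1.115)–(1.116) open p. 96 [PDF 22] (`p0022.txt` L4/L6);
the prose «Using the equality (213) [3] …» is p. 96 L2 as cited; declarations byte-identical with v1.0 (p239571).

THE PRINTED TEXT (pp. 95–97).  «We want to construct a function D′(λ) for α₃, α₄ sufficiently small, whose values are
configurations X : 𝔅_k → 𝔤, such that the transformation λ′ = λ − H′D′(λ) (1.113) changes the function Q′(λ′) into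
the linear function Q′λ: Q′(λ − H′D′(λ)) = Q′λ. (1.114)  Using the equality (213) [3] the above equation can be written
in the following form: Q′λ − Q′H′D′(λ) + C′(λ − H′D′(λ)) = Q′λ, (1.115) hence −D′(λ) + C′(λ − H′D′(λ)) = 0. (1.116)
The function D′(λ) is a solution of the equation C′(λ − H′X) = X, (1.117) or a fixed point of the transformation
X → C′(λ − H′X). (1.118) … Let us assume that |λ| < ½α₄, |Dλ| < ½α₄(Lʲη)⁻¹ on Ω_j, |X| < α₄/(2B′₀). (1.119)  This
implies |λ − H′X| < α₄, |D(λ − H′X)| < α₄(Lʲη)⁻¹ on Ω_j, (1.120) and by the inequality (214) we have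
|C′(λ − H′X)| < C′₂(α₃ + α₄)α₄, (1.121) where the constant O(1) in (214) [3] was denoted by C′₂.  The transformation
(1.118) maps the set (1.119) of X's into itself if C′₂(α₃ + α₄)α₄ ≤ α₄/(2B′₀), or α₃ + α₄ ≤ 1/(2B′₀C′₂). …»
(p. 97, after (1.125)) «Applying it to the expression (1.122) we have |C′(λ − H′X₁) − C′(λ − H′X₂)| ≤
C′₂2B′₀(α₃ + α₄)|X₁ − X₂|, hence the mapping (1.118) is contractive if e.g. α₃ + α₄ ≤ 1/(4C′₂B′₀).  If the last
condition is satisfied, then the mapping transforms the set {|X| < α₄/(2B′₀)} into itself and is contractive on this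
set. Thus by the contraction mapping theorem there exists exactly one solution of Eq. (1.117). This solution is an
analytic function of λ defined on the set of λ satisfying (1.119). We take D′(λ) equal to this solution. From
Eq. (1.116) we can get much better bounds on it: |D′(λ)| = |C′(λ − H′D′(λ))| < C′₂(α₃ + α₄)α₄.»

WHAT IS TYPED / PROVED HERE (the cell's abstraction level of `…B8SectE` and `…B8SectDSource`: `Λ` = the real Banach
space of 𝔤-valued λ's with the norm `‖λ‖ := max{|λ|, sup_j (Lʲη)|Dλ| on Ω_j}` — so the sets of (1.119)/(1.120) are
norm balls — and `F` = the space of X : 𝔅_k → 𝔤 with the sup norm; `C′ : Λ → F` the non-linear part of the averaging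
(213) of [3] with the printed bounds (1.121) [(214) of [3]] and (1.125) as HYPOTHESES; `H′ : F →L[ℝ] Λ` with
‖H′‖ ≤ B′₀ = (1.92)):
* `Eq1117` — the fixed-point equation (1.117) as a predicate (definition with body);
* `eq1117_existsUnique` — PROVED: under (1.121), (1.125), ‖H′‖ ≤ B′₀ and the printed smallness
  α₃ + α₄ ≤ 1/(4B′₀C′₂), for every λ with ‖λ‖ < ½α₄ there is exactly one X with ‖X‖ ≤ α₄/(2B′₀) solving (1.117)
  ("by the contraction mapping theorem there exists exactly one solution of Eq. (1.117)" — Banach's theorem on the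
  closed ball, `B8SectDSource.fixedPoint_closedBall`; print's open set (1.119) is replaced by its closure, which only
  enlarges the uniqueness domain);
* `Dprime` — D′(λ) := that solution (definition with body, by choice; `0` off the domain) with `Dprime_spec`,
  `Dprime_unique`; `Dprime_bound` — PROVED: «|D′(λ)| = |C′(λ − H′D′(λ))| < C′₂(α₃ + α₄)α₄» (p. 97);
* `linMap` — the linearizing transformation (1.113) λ ↦ λ − H′D′(λ) (definition with body); `linMap_mem` — it maps
  the ball ‖λ‖ < ½α₄ into the ball ‖λ′‖ < α₄ (the (1.120)-type bound used on p. 97);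
* `eq1114` — PROVED (pure additive algebra): if Q′(u₁, μ) = Q′μ + C′(μ) [(213) of [3]] and Q′H′ = I [p. 96], then any
  solution X of (1.117) gives Q′(u₁, λ − H′X) = Q′λ, i.e. (1.115) ⇒ (1.114); `eq1114_Dprime` the instance X = D′(λ).
NOT typed here (other blocks / already in the tree): the Lipschitz continuity of D′ and the ONTO sentence of p. 97
(`B8SectE.fixedPoint_lipschitz`, `B8SectE.onto_of_lipschitz_half`, cell GAPS G-B8-05); the Cauchy-formula step
(1.122)–(1.125) (`B8Ineq125`); analyticity of D′ in λ; the concrete C′ of (213)–(214) [3] and H′ of (1.91)–(1.92)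
(interface requests I-B8-4 / I-B8-2 of `HOME/lit-balaban-r05/INTERFACES-B8.md`).  Nothing here is new mathematics.
-/

noncomputable section

namespace Literature.MathematicalPhysics.QuantumFieldTheory.Balaban1983to89.B8SectEStatements

open Metric

variable {Λ F : Type*} [NormedAddCommGroup Λ] [NormedSpace ℝ Λ] [NormedAddCommGroup F] [NormedSpace ℝ F]

/-! ## §1 The fixed-point equation (1.117) and its unique solvability on the set (1.119) -/

/-- **(1.117)** p. 96 [PDF 22], verbatim: *"The function D′(λ) is a solution of the equation C′(λ − H′X) = X, (1.117)
or a fixed point of the transformation X → C′(λ − H′X). (1.118)"* — the equation as a predicate on X, for the data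
C′ (non-linear part of the averaging, (213) of [3]) and H′ ((1.91)). [cite: Balaban1985RegularSpaces, (1.117) p.96] -/
def Eq1117 (C' : Λ → F) (H' : F →L[ℝ] Λ) (lam : Λ) (X : F) : Prop :=
  C' (lam - H' X) = X

/-- (1.120) p. 96: on the set (1.119) (‖λ‖ < ½α₄, ‖X‖ ≤ α₄/(2B′₀)) and with ‖H′‖ ≤ B′₀ ((1.92)), the argument of C′
satisfies «|λ − H′X| < α₄» (norm form). [cite: Balaban1985RegularSpaces, (1.120) p.96] -/
theorem norm_arg_lt (H' : F →L[ℝ] Λ) {B₀' α₄ : ℝ} (hB : 0 < B₀') (hH : ‖H'‖ ≤ B₀')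
    {lam : Λ} (hlam : ‖lam‖ < α₄ / 2) {X : F} (hX : ‖X‖ ≤ α₄ / (2 * B₀')) :
    ‖lam - H' X‖ < α₄ := by
  have hHX : ‖H' X‖ ≤ α₄ / 2 :=
    calc ‖H' X‖ ≤ ‖H'‖ * ‖X‖ := H'.le_opNorm X
      _ ≤ B₀' * (α₄ / (2 * B₀')) := mul_le_mul hH hX (norm_nonneg _) hB.le
      _ = α₄ / 2 := by field_simp
  calc ‖lam - H' X‖ ≤ ‖lam‖ + ‖H' X‖ := norm_sub_le _ _
    _ < α₄ / 2 + α₄ / 2 := by linarith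
    _ = α₄ := by ring

/-- **Existence and uniqueness of the solution of (1.117)** (p. 97 [PDF 23], verbatim: *"hence the mapping (1.118)
is contractive if e.g. α₃ + α₄ ≤ 1/(4C′₂B′₀). If the last condition is satisfied, then the mapping transforms the set
{|X| < α₄/(2B′₀)} into itself and is contractive on this set. Thus by the contraction mapping theorem there exists
exactly one solution of Eq. (1.117)."*), PROVED at the abstract level: hypotheses = the printed inputs (1.121)
[«|C′(μ)| < C′₂(α₃ + α₄)α₄ for |μ| < α₄», from (214) of [3]], (1.125) [C′ is 2C′₂(α₃ + α₄)-Lipschitz on |μ| < α₄],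
‖H′‖ ≤ B′₀ [(1.92)], and the printed smallness α₃ + α₄ ≤ 1/(4B′₀C′₂); conclusion on the CLOSED ball
‖X‖ ≤ α₄/(2B′₀) (⊇ the printed open set (1.119)). [cite: Balaban1985RegularSpaces, (1.117)–(1.121) pp.96–97] -/
theorem eq1117_existsUnique [CompleteSpace F] (C' : Λ → F) (H' : F →L[ℝ] Λ) {B₀' C₂' α₃ α₄ : ℝ}
    (hB : 0 < B₀') (hC : 0 < C₂') (h3 : 0 ≤ α₃) (h4 : 0 < α₄) (hH : ‖H'‖ ≤ B₀')
    (h121 : ∀ μ : Λ, ‖μ‖ < α₄ → ‖C' μ‖ < C₂' * (α₃ + α₄) * α₄)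
    (h125 : ∀ μ₁ μ₂ : Λ, ‖μ₁‖ < α₄ → ‖μ₂‖ < α₄ → ‖C' μ₁ - C' μ₂‖ ≤ 2 * C₂' * (α₃ + α₄) * ‖μ₁ - μ₂‖)
    (hsm : α₃ + α₄ ≤ 1 / (4 * B₀' * C₂')) {lam : Λ} (hlam : ‖lam‖ < α₄ / 2) :
    ∃! X : F, ‖X‖ ≤ α₄ / (2 * B₀') ∧ Eq1117 C' H' lam X := by
  -- the printed smallness in product form: C′₂(α₃+α₄)·B′₀ ≤ 1/4
  have hprod : C₂' * (α₃ + α₄) * B₀' ≤ 1 / 4 := by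
    have h1 : C₂' * (α₃ + α₄) * B₀' ≤ C₂' * (1 / (4 * B₀' * C₂')) * B₀' :=
      mul_le_mul_of_nonneg_right (mul_le_mul_of_nonneg_left hsm hC.le) hB.le
    have h2 : C₂' * (1 / (4 * B₀' * C₂')) * B₀' = 1 / 4 := by field_simp
    linarith
  have hρ : 0 ≤ α₄ / (2 * B₀') := by positivity
  refine B8SectDSource.fixedPoint_closedBall (fun X => C' (lam - H' X)) hρ (κ := 2 * C₂' * (α₃ + α₄) * B₀')
    (by positivity) (by linarith) ?_ ?_
  · -- self-map of the ball: (1.120) then (1.121) then C′₂(α₃+α₄)α₄ ≤ α₄/(2B′₀)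
    intro X hX
    have harg : ‖lam - H' X‖ < α₄ := norm_arg_lt H' hB hH hlam hX
    have h1 : ‖C' (lam - H' X)‖ < C₂' * (α₃ + α₄) * α₄ := h121 _ harg
    have h2 : C₂' * (α₃ + α₄) * α₄ ≤ α₄ / (2 * B₀') := by
      rw [le_div_iff₀ (by positivity)]
      nlinarith
    exact (h1.trans_le h2).le
  · -- contraction: (1.125) composed with ‖H′‖ ≤ B′₀
    intro X Y hX hY
    have hX' : ‖lam - H' X‖ < α₄ := norm_arg_lt H' hB hH hlam hX
    have hY' : ‖lam - H' Y‖ < α₄ := norm_arg_lt H' hB hH hlam hY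
    have hdiff : (lam - H' X) - (lam - H' Y) = H' (Y - X) := by rw [map_sub]; abel
    calc ‖C' (lam - H' X) - C' (lam - H' Y)‖
        ≤ 2 * C₂' * (α₃ + α₄) * ‖(lam - H' X) - (lam - H' Y)‖ := h125 _ _ hX' hY'
      _ = 2 * C₂' * (α₃ + α₄) * ‖H' (Y - X)‖ := by rw [hdiff]
      _ ≤ 2 * C₂' * (α₃ + α₄) * (B₀' * ‖X - Y‖) := by
          refine mul_le_mul_of_nonneg_left ?_ (by positivity)
          calc ‖H' (Y - X)‖ ≤ ‖H'‖ * ‖Y - X‖ := H'.le_opNorm _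
            _ ≤ B₀' * ‖X - Y‖ := by
                rw [norm_sub_rev Y X]; exact mul_le_mul_of_nonneg_right hH (norm_nonneg _)
      _ = 2 * C₂' * (α₃ + α₄) * B₀' * ‖X - Y‖ := by ring

/-! ## §2 The function `D′(λ)` and its bound (p. 97) -/

open Classical in
/-- **D′(λ)** p. 97 [PDF 23], verbatim: *"We take D′(λ) equal to this solution"* [of (1.117) in the set
|X| < α₄/(2B′₀)] — typed by choice: the solution of (1.117) in the closed ball of radius ρ (= α₄/(2B′₀)) when one
exists, `0` otherwise (off the domain (1.119) the paper does not define D′). [cite: Balaban1985RegularSpaces, (1.117) p.96; p.97 (definition of D′)] -/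
def Dprime (C' : Λ → F) (H' : F →L[ℝ] Λ) (ρ : ℝ) (lam : Λ) : F :=
  if h : ∃ X : F, ‖X‖ ≤ ρ ∧ Eq1117 C' H' lam X then h.choose else 0

/-- On the domain ‖λ‖ < ½α₄, D′(λ) lies in the ball ‖X‖ ≤ α₄/(2B′₀) and solves (1.117) (from
`eq1117_existsUnique`). [cite: Balaban1985RegularSpaces, (1.117) p.96; p.97 (definition of D′)] -/
theorem Dprime_spec [CompleteSpace F] (C' : Λ → F) (H' : F →L[ℝ] Λ) {B₀' C₂' α₃ α₄ : ℝ}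
    (hB : 0 < B₀') (hC : 0 < C₂') (h3 : 0 ≤ α₃) (h4 : 0 < α₄) (hH : ‖H'‖ ≤ B₀')
    (h121 : ∀ μ : Λ, ‖μ‖ < α₄ → ‖C' μ‖ < C₂' * (α₃ + α₄) * α₄)
    (h125 : ∀ μ₁ μ₂ : Λ, ‖μ₁‖ < α₄ → ‖μ₂‖ < α₄ → ‖C' μ₁ - C' μ₂‖ ≤ 2 * C₂' * (α₃ + α₄) * ‖μ₁ - μ₂‖)
    (hsm : α₃ + α₄ ≤ 1 / (4 * B₀' * C₂')) {lam : Λ} (hlam : ‖lam‖ < α₄ / 2) :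
    ‖Dprime C' H' (α₄ / (2 * B₀')) lam‖ ≤ α₄ / (2 * B₀') ∧
      Eq1117 C' H' lam (Dprime C' H' (α₄ / (2 * B₀')) lam) := by
  have hex : ∃ X : F, ‖X‖ ≤ α₄ / (2 * B₀') ∧ Eq1117 C' H' lam X :=
    (eq1117_existsUnique C' H' hB hC h3 h4 hH h121 h125 hsm hlam).exists
  unfold Dprime
  rw [dif_pos hex]
  exact hex.choose_spec

/-- Uniqueness: any solution of (1.117) in the ball ‖X‖ ≤ α₄/(2B′₀) IS D′(λ) ("exactly one solution of
Eq. (1.117)", p. 97). [cite: Balaban1985RegularSpaces, (1.117) p.96; p.97] -/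
theorem Dprime_unique [CompleteSpace F] (C' : Λ → F) (H' : F →L[ℝ] Λ) {B₀' C₂' α₃ α₄ : ℝ}
    (hB : 0 < B₀') (hC : 0 < C₂') (h3 : 0 ≤ α₃) (h4 : 0 < α₄) (hH : ‖H'‖ ≤ B₀')
    (h121 : ∀ μ : Λ, ‖μ‖ < α₄ → ‖C' μ‖ < C₂' * (α₃ + α₄) * α₄)
    (h125 : ∀ μ₁ μ₂ : Λ, ‖μ₁‖ < α₄ → ‖μ₂‖ < α₄ → ‖C' μ₁ - C' μ₂‖ ≤ 2 * C₂' * (α₃ + α₄) * ‖μ₁ - μ₂‖)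
    (hsm : α₃ + α₄ ≤ 1 / (4 * B₀' * C₂')) {lam : Λ} (hlam : ‖lam‖ < α₄ / 2)
    {X : F} (hX : ‖X‖ ≤ α₄ / (2 * B₀')) (hsol : Eq1117 C' H' lam X) :
    X = Dprime C' H' (α₄ / (2 * B₀')) lam := by
  have hu := eq1117_existsUnique C' H' hB hC h3 h4 hH h121 h125 hsm hlam
  have hD := Dprime_spec C' H' hB hC h3 h4 hH h121 h125 hsm hlam
  exact hu.unique ⟨hX, hsol⟩ hD

/-- **The bound on D′** p. 97 [PDF 23], verbatim: *"From Eq. (1.116) we can get much better bounds on it: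
|D′(λ)| = |C′(λ − H′D′(λ))| < C′₂(α₃ + α₄)α₄."* — PROVED from (1.117) and (1.121).
[cite: Balaban1985RegularSpaces, p.97 (bound on D′ after (1.125))] -/
theorem Dprime_bound [CompleteSpace F] (C' : Λ → F) (H' : F →L[ℝ] Λ) {B₀' C₂' α₃ α₄ : ℝ}
    (hB : 0 < B₀') (hC : 0 < C₂') (h3 : 0 ≤ α₃) (h4 : 0 < α₄) (hH : ‖H'‖ ≤ B₀')
    (h121 : ∀ μ : Λ, ‖μ‖ < α₄ → ‖C' μ‖ < C₂' * (α₃ + α₄) * α₄)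
    (h125 : ∀ μ₁ μ₂ : Λ, ‖μ₁‖ < α₄ → ‖μ₂‖ < α₄ → ‖C' μ₁ - C' μ₂‖ ≤ 2 * C₂' * (α₃ + α₄) * ‖μ₁ - μ₂‖)
    (hsm : α₃ + α₄ ≤ 1 / (4 * B₀' * C₂')) {lam : Λ} (hlam : ‖lam‖ < α₄ / 2) :
    ‖Dprime C' H' (α₄ / (2 * B₀')) lam‖ < C₂' * (α₃ + α₄) * α₄ := by
  obtain ⟨hball, hsol⟩ := Dprime_spec C' H' hB hC h3 h4 hH h121 h125 hsm hlam
  have harg : ‖lam - H' (Dprime C' H' (α₄ / (2 * B₀')) lam)‖ < α₄ := norm_arg_lt H' hB hH hlam hball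
  have h := h121 _ harg
  unfold Eq1117 at hsol
  rwa [hsol] at h

/-! ## §3 The linearizing transformation (1.113) and the identity (1.114) -/

/-- **(1.113)** p. 95 [PDF 21], verbatim: *"the transformation λ′ = λ − H′D′(λ) (1.113)"* (D′ taken in the ball of
radius ρ = α₄/(2B′₀)). [cite: Balaban1985RegularSpaces, (1.113) p.95] -/
def linMap (C' : Λ → F) (H' : F →L[ℝ] Λ) (ρ : ℝ) (lam : Λ) : Λ :=
  lam - H' (Dprime C' H' ρ lam)

/-- The linearizing transformation maps the ball ‖λ‖ < ½α₄ into the ball ‖λ′‖ < α₄ (the (1.120) bound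
«|λ − H′X| < α₄» at X = D′(λ)). [cite: Balaban1985RegularSpaces, (1.120) p.96] -/
theorem norm_linMap_lt [CompleteSpace F] (C' : Λ → F) (H' : F →L[ℝ] Λ) {B₀' C₂' α₃ α₄ : ℝ}
    (hB : 0 < B₀') (hC : 0 < C₂') (h3 : 0 ≤ α₃) (h4 : 0 < α₄) (hH : ‖H'‖ ≤ B₀')
    (h121 : ∀ μ : Λ, ‖μ‖ < α₄ → ‖C' μ‖ < C₂' * (α₃ + α₄) * α₄)
    (h125 : ∀ μ₁ μ₂ : Λ, ‖μ₁‖ < α₄ → ‖μ₂‖ < α₄ → ‖C' μ₁ - C' μ₂‖ ≤ 2 * C₂' * (α₃ + α₄) * ‖μ₁ - μ₂‖)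
    (hsm : α₃ + α₄ ≤ 1 / (4 * B₀' * C₂')) {lam : Λ} (hlam : ‖lam‖ < α₄ / 2) :
    ‖linMap C' H' (α₄ / (2 * B₀')) lam‖ < α₄ :=
  norm_arg_lt H' hB hH hlam (Dprime_spec C' H' hB hC h3 h4 hH h121 h125 hsm hlam).1

/-- **(1.114) from (1.115)–(1.117)** p. 96 [PDF 22]: *"Using the equality (213) [3] the above equation can be written
in the following form: Q′λ − Q′H′D′(λ) + C′(λ − H′D′(λ)) = Q′λ, (1.115) hence −D′(λ) + C′(λ − H′D′(λ)) = 0.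
(1.116)"* — PROVED as additive algebra: if the full averaging function satisfies Q′(u₁, μ) = Q′μ + C′(μ) [(213) of
[3]; `Qfull`, `Q`] and Q′H′ = I [p. 96, from H′ = G′²Q′*(Q′G′²Q′*)⁻¹], then every solution X of (1.117) gives
Q′(u₁, λ − H′X) = Q′λ, i.e. (1.114). [cite: Balaban1985RegularSpaces, (1.114) p.95, (1.115)–(1.116) p.96] -/
theorem eq1114 (Qfull : Λ → F) (Q : Λ →+ F) (C' : Λ → F) (H' : F →L[ℝ] Λ)
    (h213 : ∀ μ : Λ, Qfull μ = Q μ + C' μ) (hQH : ∀ X : F, Q (H' X) = X)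
    {lam : Λ} {X : F} (hsol : Eq1117 C' H' lam X) :
    Qfull (lam - H' X) = Q lam := by
  unfold Eq1117 at hsol
  rw [h213, map_sub, hQH, hsol]
  abel

/-- (1.114) for the constructed D′: Q′(u₁, λ − H′D′(λ)) = Q′λ on the domain ‖λ‖ < ½α₄.
[cite: Balaban1985RegularSpaces, (1.114) p.95] -/
theorem eq1114_Dprime [CompleteSpace F] (Qfull : Λ → F) (Q : Λ →+ F) (C' : Λ → F) (H' : F →L[ℝ] Λ)
    (h213 : ∀ μ : Λ, Qfull μ = Q μ + C' μ) (hQH : ∀ X : F, Q (H' X) = X) {B₀' C₂' α₃ α₄ : ℝ}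
    (hB : 0 < B₀') (hC : 0 < C₂') (h3 : 0 ≤ α₃) (h4 : 0 < α₄) (hH : ‖H'‖ ≤ B₀')
    (h121 : ∀ μ : Λ, ‖μ‖ < α₄ → ‖C' μ‖ < C₂' * (α₃ + α₄) * α₄)
    (h125 : ∀ μ₁ μ₂ : Λ, ‖μ₁‖ < α₄ → ‖μ₂‖ < α₄ → ‖C' μ₁ - C' μ₂‖ ≤ 2 * C₂' * (α₃ + α₄) * ‖μ₁ - μ₂‖)
    (hsm : α₃ + α₄ ≤ 1 / (4 * B₀' * C₂')) {lam : Λ} (hlam : ‖lam‖ < α₄ / 2) :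
    Qfull (linMap C' H' (α₄ / (2 * B₀')) lam) = Q lam :=
  eq1114 Qfull Q C' H' h213 hQH (Dprime_spec C' H' hB hC h3 h4 hH h121 h125 hsm hlam).2

end Literature.MathematicalPhysics.QuantumFieldTheory.Balaban1983to89.B8SectEStatements
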